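import Mathlib
import Literature.AlgebraicGeometry.Resolution.FormalCoordinateChange

/-!
# Degree-2 bookkeeping for the cone dichotomy (auxiliary file)

Crux `LocalWeightedDrop` (stmt-ResolutionOfSingularities-8899, route
ResolutionOfSingularities/WeightedInvariant), line `hasse-ridge-face-selection`: auxiliary lemmas, valid
over any field `k`, for the registered stub `stub_coneDichotomy` (file
`WeightedInvariantLocalWeightedDropConeDichotomy`).

* Quadratic forms in characteristic-free form are (not necessarily symmetric) coefficient matrices `c`,
  `Q(v) = v ⬝ᵥ c *ᵥ v`, with polar form `B(v,w) = Q(v+w) - Q(v) - Q(w) = v ⬝ᵥ c *ᵥ w + w ⬝ᵥ c *ᵥ v`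
  (`qf_lin`, `bf_lin_left/right`, values on basis vectors `qf_single`, `bf_single_single`).
* The quadratic polynomial `∑ c_ab X_a X_b ∈ k[[x]]` of `c` and its degree-`2` coefficients
  (`coeff_pair_quadP`: `c_ii` on `2eᵢ`, `c_ij + c_ji` on `eᵢ + eⱼ`); the square of a linear form
  (`sq_linear_eq_quadP`); the product of two components of a linear substitution
  (`linSubst_mul_linSubst`).
* A germ `f ∈ 𝔪²` has a matrix `c` of degree-`2` coefficients (`exists_quadMat`, upper triangular),
  `f = ∑ c_ab X_a X_b + (order ≥ 3)` (`three_le_order_sub_quadP`), and the BOOKKEEPING LEMMA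
  `stub_coneDichotomyQuadSubst` (registered sub-goal of `stub_coneDichotomy`): the degree-`2`
  coefficients of `f ∘ (x ↦ M x)` (the linear substitution `FormalCoordChange.linSubst M`) are
  `Q(col_i M)` on `2eᵢ` and `B(col_i M, col_j M)` on `eᵢ + eⱼ` (`i ≠ j`) — a linear substitution acts
  on the degree-`2` part by matrix congruence and does not mix in other degrees.
-/

set_option linter.dupNamespace false -- mandated namespace of this single-conjunct summit

namespace Summit.ResolutionOfSingularities.ResolutionOfSingularities.Theorems

open Literature.AlgebraicGeometry.Resolution
open MvPowerSeries
open scoped Matrix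

namespace ConeDichotomy

variable {k : Type*} [Field k] {N : ℕ}

/-! ### Quadratic forms `v ⬝ᵥ c *ᵥ v` of coefficient matrices -/

/-- `Q` on a binary pencil: `Q(s v + t w) = s² Q(v) + t² Q(w) + s t B(v,w)`. -/
theorem qf_lin (c : Matrix (Fin N) (Fin N) k) (s t : k) (v w : Fin N → k) :
    (s • v + t • w) ⬝ᵥ c *ᵥ (s • v + t • w) = s ^ 2 * (v ⬝ᵥ c *ᵥ v) + t ^ 2 * (w ⬝ᵥ c *ᵥ w) +
      s * t * (v ⬝ᵥ c *ᵥ w + w ⬝ᵥ c *ᵥ v) := by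
  simp only [Matrix.mulVec_add, Matrix.mulVec_smul, dotProduct_add, add_dotProduct, dotProduct_smul,
    smul_dotProduct, smul_eq_mul]
  ring

/-- The polar form `B(v,w) = v ⬝ᵥ c *ᵥ w + w ⬝ᵥ c *ᵥ v` is linear in the first slot. -/
theorem bf_lin_left (c : Matrix (Fin N) (Fin N) k) (s t : k) (v w x : Fin N → k) :
    (s • v + t • w) ⬝ᵥ c *ᵥ x + x ⬝ᵥ c *ᵥ (s • v + t • w) =
      s * (v ⬝ᵥ c *ᵥ x + x ⬝ᵥ c *ᵥ v) + t * (w ⬝ᵥ c *ᵥ x + x ⬝ᵥ c *ᵥ w) := by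
  simp only [Matrix.mulVec_add, Matrix.mulVec_smul, dotProduct_add, add_dotProduct, dotProduct_smul,
    smul_dotProduct, smul_eq_mul]
  ring

/-- The polar form is linear in the second slot. -/
theorem bf_lin_right (c : Matrix (Fin N) (Fin N) k) (s t : k) (x v w : Fin N → k) :
    x ⬝ᵥ c *ᵥ (s • v + t • w) + (s • v + t • w) ⬝ᵥ c *ᵥ x =
      s * (x ⬝ᵥ c *ᵥ v + v ⬝ᵥ c *ᵥ x) + t * (x ⬝ᵥ c *ᵥ w + w ⬝ᵥ c *ᵥ x) := by
  simp only [Matrix.mulVec_add, Matrix.mulVec_smul, dotProduct_add, add_dotProduct, dotProduct_smul,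
    smul_dotProduct, smul_eq_mul]
  ring

/-- `Q(eᵢ) = c_ii`. -/
theorem qf_single (c : Matrix (Fin N) (Fin N) k) (i : Fin N) :
    Pi.single i 1 ⬝ᵥ c *ᵥ Pi.single i 1 = c i i := by
  rw [Matrix.mulVec_single_one, single_one_dotProduct, Matrix.col_apply]

/-- `B(eᵢ, eⱼ) = c_ij + c_ji`. -/
theorem bf_single_single (c : Matrix (Fin N) (Fin N) k) (i j : Fin N) :
    Pi.single i 1 ⬝ᵥ c *ᵥ Pi.single j 1 + Pi.single j 1 ⬝ᵥ c *ᵥ Pi.single i 1 = c i j + c j i := by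
  rw [Matrix.mulVec_single_one, single_one_dotProduct, Matrix.col_apply, Matrix.mulVec_single_one,
    single_one_dotProduct, Matrix.col_apply]

/-- `v ⬝ᵥ c *ᵥ w` as a double sum. -/
theorem dotProduct_mulVec_eq_sum (c : Matrix (Fin N) (Fin N) k) (v w : Fin N → k) :
    v ⬝ᵥ c *ᵥ w = ∑ a, ∑ b, c a b * (v a * w b) := by
  simp only [dotProduct, Matrix.mulVec, Finset.mul_sum]
  exact Finset.sum_congr rfl fun a _ => Finset.sum_congr rfl fun b _ => by ring

/-! ### Quadratic polynomials `∑ c_ab X_a X_b` and their degree-2 coefficients -/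

/-- Coefficients of `X_a X_b`. -/
theorem coeff_X_mul_X (e : Fin N →₀ ℕ) (a b : Fin N) :
    coeff e (X a * X b : MvPowerSeries (Fin N) k) =
      if e = Finsupp.single a 1 + Finsupp.single b 1 then 1 else 0 := by
  classical
  rw [X_def, X_def, monomial_mul_monomial, one_mul, coeff_monomial]

/-- Coefficients of a quadratic polynomial. -/
theorem coeff_quadP (c : Matrix (Fin N) (Fin N) k) (e : Fin N →₀ ℕ) :
    coeff e (∑ a, ∑ b, c a b • (X a * X b : MvPowerSeries (Fin N) k)) =
      ∑ a, ∑ b, if e = Finsupp.single a 1 + Finsupp.single b 1 then c a b else 0 := by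
  classical
  simp only [map_sum, map_smul, coeff_X_mul_X, smul_eq_mul, mul_ite, mul_one, mul_zero]

/-- A quadratic polynomial has no coefficients off degree `2`. -/
theorem coeff_quadP_of_degree_ne_two (c : Matrix (Fin N) (Fin N) k) {e : Fin N →₀ ℕ}
    (he : e.degree ≠ 2) : coeff e (∑ a, ∑ b, c a b • (X a * X b : MvPowerSeries (Fin N) k)) = 0 := by
  rw [coeff_quadP]
  refine Finset.sum_eq_zero fun a _ => Finset.sum_eq_zero fun b _ => if_neg ?_
  rintro rfl
  apply he
  rw [map_add, Finsupp.degree_single, Finsupp.degree_single]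

/-- `eᵢ + eⱼ = e_a + e_b` iff `{i,j} = {a,b}`. -/
theorem single_add_single_eq_iff (i j a b : Fin N) :
    (Finsupp.single i 1 + Finsupp.single j 1 : Fin N →₀ ℕ) =
        Finsupp.single a 1 + Finsupp.single b 1 ↔ (a = i ∧ b = j) ∨ (a = j ∧ b = i) := by
  rw [Finsupp.single_add_single_eq_single_add_single one_ne_zero one_ne_zero]
  constructor
  · rintro (⟨rfl, rfl⟩ | ⟨-, rfl, rfl⟩ | ⟨h, -, -⟩)
    · exact Or.inl ⟨rfl, rfl⟩
    · exact Or.inr ⟨rfl, rfl⟩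
    · exact absurd h (by norm_num)
  · rintro (⟨rfl, rfl⟩ | ⟨rfl, rfl⟩)
    · exact Or.inl ⟨rfl, rfl⟩
    · exact Or.inr (Or.inl ⟨rfl, rfl, rfl⟩)

/-- The degree-`2` coefficients of a quadratic polynomial: `c_ii` on `2eᵢ` and `c_ij + c_ji` on
`eᵢ + eⱼ` (`i ≠ j`). -/
theorem coeff_pair_quadP (c : Matrix (Fin N) (Fin N) k) (i j : Fin N) :
    coeff (Finsupp.single i 1 + Finsupp.single j 1)
        (∑ a, ∑ b, c a b • (X a * X b : MvPowerSeries (Fin N) k)) =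
      if i = j then c i i else c i j + c j i := by
  classical
  rw [coeff_quadP]
  simp_rw [single_add_single_eq_iff]
  by_cases hij : i = j
  · subst hij
    simp [ite_and]
  · rw [if_neg hij]
    have hsplit : ∀ a b : Fin N, (if (a = i ∧ b = j) ∨ (a = j ∧ b = i) then c a b else 0) =
        (if a = i ∧ b = j then c a b else 0) + (if a = j ∧ b = i then c a b else 0) := by
      intro a b
      by_cases h1 : a = i ∧ b = j
      · have h2 : ¬ (a = j ∧ b = i) := fun h2 => hij (h1.1.symm.trans h2.1)
        rw [if_pos (Or.inl h1), if_pos h1, if_neg h2, add_zero]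
      · by_cases h2 : a = j ∧ b = i
        · rw [if_pos (Or.inr h2), if_neg h1, if_pos h2, zero_add]
        · rw [if_neg h1, if_neg h2, add_zero, if_neg (by tauto)]
    simp_rw [hsplit, Finset.sum_add_distrib]
    simp [ite_and]

/-- `2eᵢ = eᵢ + eᵢ`. -/
theorem single_two_eq (i : Fin N) :
    (Finsupp.single i 2 : Fin N →₀ ℕ) = Finsupp.single i 1 + Finsupp.single i 1 := by
  rw [← Finsupp.single_add]

/-- An exponent of degree `2` is `eᵢ + eⱼ`. -/
theorem exists_eq_single_add_single (e : Fin N →₀ ℕ) (he : e.degree = 2) :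
    ∃ i j : Fin N, e = Finsupp.single i 1 + Finsupp.single j 1 := by
  classical
  have hcard : Multiset.card (Finsupp.toMultiset e) = 2 := by
    rw [Finsupp.card_toMultiset, ← he]
    rfl
  obtain ⟨x, y, hxy⟩ := Multiset.card_eq_two.mp hcard
  rw [Finsupp.toMultiset_eq_iff] at hxy
  refine ⟨x, y, ?_⟩
  rw [hxy, Multiset.insert_eq_cons, ← Multiset.singleton_add, Multiset.toFinsupp_add,
    Multiset.toFinsupp_singleton, Multiset.toFinsupp_singleton]

/-- The product of two components of the linear substitution `x ↦ M x` is the quadratic polynomial of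
the matrix `(M_aj M_bl)_{j,l}`. -/
theorem linSubst_mul_linSubst (M : Matrix (Fin N) (Fin N) k) (a b : Fin N) :
    FormalCoordChange.linSubst M a * FormalCoordChange.linSubst M b =
      ∑ j, ∑ l, Matrix.of (fun j l => M a j * M b l) j l • (X j * X l) := by
  simp only [FormalCoordChange.linSubst, Finset.sum_mul_sum, smul_mul_smul_comm, Matrix.of_apply]

/-- The square of a linear form is the quadratic polynomial of the matrix `(ℓ_a ℓ_b)`. -/
theorem sq_linear_eq_quadP (ℓ : Fin N → k) :
    (∑ l, C (ℓ l) * X l : MvPowerSeries (Fin N) k) ^ 2 =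
      ∑ a, ∑ b, Matrix.of (fun a b => ℓ a * ℓ b) a b • (X a * X b) := by
  simp only [sq, Finset.sum_mul_sum, smul_eq_C_mul, map_mul, Matrix.of_apply]
  exact Finset.sum_congr rfl fun a _ => Finset.sum_congr rfl fun b _ => by ring

/-- Degree-`2` coefficients of a quadratic polynomial after the linear substitution `x ↦ M x`:
`Q(col_i M)` on `2eᵢ` and `B(col_i M, col_j M)` on `eᵢ + eⱼ` (matrix congruence). -/
theorem coeff_pair_subst_quadP (M : Matrix (Fin N) (Fin N) k) (c : Matrix (Fin N) (Fin N) k)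
    (i j : Fin N) :
    coeff (Finsupp.single i 1 + Finsupp.single j 1)
        (subst (FormalCoordChange.linSubst M)
          (∑ a, ∑ b, c a b • (X a * X b : MvPowerSeries (Fin N) k))) =
      if i = j then Mᵀ i ⬝ᵥ c *ᵥ Mᵀ i else Mᵀ i ⬝ᵥ c *ᵥ Mᵀ j + Mᵀ j ⬝ᵥ c *ᵥ Mᵀ i := by
  have hs : subst (FormalCoordChange.linSubst M)
      (∑ a, ∑ b, c a b • (X a * X b : MvPowerSeries (Fin N) k)) =
      ∑ a, ∑ b, c a b • (FormalCoordChange.linSubst M a * FormalCoordChange.linSubst M b) := by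
    rw [← coe_substAlgHom (FormalCoordChange.hasSubst_linSubst M), map_sum]
    refine Finset.sum_congr rfl fun a _ => ?_
    rw [map_sum]
    refine Finset.sum_congr rfl fun b _ => ?_
    rw [map_smul, map_mul, substAlgHom_X, substAlgHom_X]
  rw [hs, map_sum]
  simp_rw [map_sum, map_smul, linSubst_mul_linSubst, coeff_pair_quadP, Matrix.of_apply, smul_eq_mul]
  by_cases hij : i = j
  · subst hij
    simp only [if_true, dotProduct_mulVec_eq_sum, Matrix.transpose_apply]
  · simp only [hij, if_false, dotProduct_mulVec_eq_sum, Matrix.transpose_apply, mul_add,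
      Finset.sum_add_distrib]

/-! ### The degree-2 part of a germ -/

/-- The degree-`2` coefficients of a germ `f` are those of the quadratic polynomial of a matrix `c`
(e.g. the upper-triangular matrix of the coefficients of `f` on `2eᵢ` and on `eᵢ + eⱼ`, `i < j`). -/
theorem exists_quadMat (f : MvPowerSeries (Fin N) k) : ∃ c : Matrix (Fin N) (Fin N) k,
    ∀ i j : Fin N, coeff (Finsupp.single i 1 + Finsupp.single j 1) f =
      if i = j then c i i else c i j + c j i := by
  refine ⟨Matrix.of fun a b => if a = b then coeff (Finsupp.single a 2) f
    else if a < b then coeff (Finsupp.single a 1 + Finsupp.single b 1) f else 0, fun i j => ?_⟩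
  by_cases hij : i = j
  · subst hij
    simp [single_two_eq]
  · rw [if_neg hij]
    simp only [Matrix.of_apply, if_neg hij, if_neg (Ne.symm hij)]
    rcases lt_or_gt_of_ne hij with h | h
    · rw [if_pos h, if_neg (not_lt.mpr h.le), add_zero]
    · rw [if_neg (not_lt.mpr h.le), if_pos h, zero_add, add_comm]

/-- `f - ∑ c_ab X_a X_b` has order `≥ 3` when `f` has no constant and no linear terms and `c`
represents its degree-`2` coefficients. -/
theorem three_le_order_sub_quadP (f : MvPowerSeries (Fin N) k) (c : Matrix (Fin N) (Fin N) k)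
    (hf0 : constantCoeff f = 0) (hf1 : ∀ i, coeff (Finsupp.single i 1) f = 0)
    (hc : ∀ i j : Fin N, coeff (Finsupp.single i 1 + Finsupp.single j 1) f =
      if i = j then c i i else c i j + c j i) :
    3 ≤ (f - ∑ a, ∑ b, c a b • (X a * X b)).order := by
  refine nat_le_order (n := 3) fun e he => ?_
  rw [map_sub, sub_eq_zero]
  by_cases h2 : e.degree = 2
  · obtain ⟨i, j, rfl⟩ := exists_eq_single_add_single e h2
    rw [coeff_pair_quadP, hc]
  · rw [coeff_quadP_of_degree_ne_two _ h2]
    have hlt : e.degree < 2 := by omega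
    rcases FormalCoordChange.eq_zero_or_single_of_degree_lt_two e hlt with rfl | ⟨i, rfl⟩
    · rwa [coeff_zero_eq_constantCoeff_apply]
    · exact hf1 i

/-- A substitution with zero constant terms does not decrease the order below `m`. -/
theorem le_order_subst_of_le {τ : Type*} (θ : Fin N → MvPowerSeries τ k)
    (hθ : ∀ i, constantCoeff (θ i) = 0) (g : MvPowerSeries (Fin N) k) (m : ℕ∞)
    (hg : m ≤ g.order) : m ≤ (subst θ g).order := by
  have h1 : (1 : ℕ∞) ≤ ⨅ i, (θ i).order :=
    le_iInf fun i => (one_le_order_iff_constCoeff_eq_zero).mpr (hθ i)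
  calc m = 1 * m := (one_mul m).symm
    _ ≤ (⨅ i, (θ i).order) * g.order := mul_le_mul' h1 hg
    _ ≤ _ := le_order_subst (hasSubst_of_constantCoeff_zero hθ) g

/-- Constant terms of a linear substitution vanish. -/
theorem constantCoeff_linSubst (M : Matrix (Fin N) (Fin N) k) (i : Fin N) :
    constantCoeff (FormalCoordChange.linSubst M i) = 0 := by
  simp [FormalCoordChange.linSubst, map_sum, constantCoeff_X]

/-- The linear part of the linear substitution `x ↦ M x` is `M`. -/
theorem linMat_linSubst (M : Matrix (Fin N) (Fin N) k) :
    (Matrix.of fun i j => coeff (Finsupp.single j 1) (FormalCoordChange.linSubst M i)) = M := by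
  classical
  ext i j
  simp [FormalCoordChange.linSubst, map_sum, coeff_index_single_X]

end ConeDichotomy

open ConeDichotomy in
/-- BOOKKEEPING (registered sub-goal `stub_coneDichotomyQuadSubst` of `stub_coneDichotomy`).  The
degree-`2` coefficients of `f ∘ (x ↦ M x)` (the linear substitution `FormalCoordChange.linSubst M`)
for a germ `f` without constant and linear terms whose degree-`2` coefficients are represented by the
matrix `c` (`coeff (eᵢ+eⱼ) f = c_ii` for `i = j`, `c_ij + c_ji` for `i ≠ j`): `Q(col_i M)` on `2eᵢ` and
`B(col_i M, col_j M)` on `eᵢ + eⱼ` (`i ≠ j`), for `Q(v) = v ⬝ᵥ c *ᵥ v` and its polar form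
`B(v,w) = v ⬝ᵥ c *ᵥ w + w ⬝ᵥ c *ᵥ v` — a linear substitution acts on the degree-`2` part by matrix
congruence and mixes in no other degree. -/
theorem stub_coneDichotomyQuadSubst : ∀ (k : Type) [Field k] (N : ℕ) (M c : Matrix (Fin N) (Fin N) k)
    (f : MvPowerSeries (Fin N) k), MvPowerSeries.constantCoeff f = 0 →
    (∀ i, MvPowerSeries.coeff (Finsupp.single i 1) f = 0) →
    (∀ i j : Fin N, MvPowerSeries.coeff (Finsupp.single i 1 + Finsupp.single j 1) f =
      if i = j then c i i else c i j + c j i) →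
    ∀ i j : Fin N, MvPowerSeries.coeff (Finsupp.single i 1 + Finsupp.single j 1)
        (MvPowerSeries.subst (FormalCoordChange.linSubst M) f) =
      if i = j then dotProduct (Matrix.transpose M i) (Matrix.mulVec c (Matrix.transpose M i))
      else dotProduct (Matrix.transpose M i) (Matrix.mulVec c (Matrix.transpose M j)) +
        dotProduct (Matrix.transpose M j) (Matrix.mulVec c (Matrix.transpose M i)) := by
  intro k _ N M c f hf0 hf1 hc i j
  set g := f - ∑ a, ∑ b, c a b • (X a * X b : MvPowerSeries (Fin N) k) with hg
  have hf : f = (∑ a, ∑ b, c a b • (X a * X b : MvPowerSeries (Fin N) k)) + g := by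
    rw [hg, add_sub_cancel]
  have h3 : (3 : ℕ∞) ≤ (subst (FormalCoordChange.linSubst M) g).order :=
    le_order_subst_of_le _ (constantCoeff_linSubst M) g 3
      (by exact_mod_cast three_le_order_sub_quadP f c hf0 hf1 hc)
  have hz : coeff (Finsupp.single i 1 + Finsupp.single j 1)
      (subst (FormalCoordChange.linSubst M) g) = 0 := by
    apply coeff_of_lt_order
    refine lt_of_lt_of_le ?_ h3
    rw [map_add, Finsupp.degree_single, Finsupp.degree_single]
    norm_num
  have hsplit : subst (FormalCoordChange.linSubst M) f =
      subst (FormalCoordChange.linSubst M)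
          (∑ a, ∑ b, c a b • (X a * X b : MvPowerSeries (Fin N) k)) +
        subst (FormalCoordChange.linSubst M) g := by
    conv_lhs => rw [hf]
    exact subst_add (FormalCoordChange.hasSubst_linSubst M) _ _
  rw [hsplit, map_add, hz, add_zero, coeff_pair_subst_quadP]

end Summit.ResolutionOfSingularities.ResolutionOfSingularities.Theorems
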